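import Summits.QuantumFields.GaugeBoot.GaugeInvariantBootstrap
import Summits.QuantumFields.GaugeBoot.WilsonLineObservables
import Summits.QuantumFields.GaugeBoot.GaugeGroupSchurAverages
import HarnessLib

/-!
# Loop positivity: the gauge average of an open-string square is a Gram matrix of Wilson loops (gauge-boot, L1 supplement)

HONEST FRAMING (cell `pub-gaugeboot`, page 1 of every file): the venture produces certified bounds
on lattice expectations at stated coupling, gauge group, dimension and torus size; NOT a mass gap,
NOT a continuum limit, NOT a string tension; NOT Yang–Mills-summit-bearing (barriers
`FixedCouplingUltralocality`, `PerturbativeInvisibility`). Structural; it certifies no number.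

`GaugeInvariantBootstrap.lean` asks positivity as (P_G) `0 ≤ ψ (A (a a))`, `A` the gauge average,
`a` any polynomial (open-string) observable. Here `A (a a)` is EVALUATED for the basic open strings
`f = Σ_j c_j ρ(hol_x(p_j))_{ab}` (matrix entries of Wilson LINES along words `p_j` from `x` to a
common `y ≠ x`) by the Schur second moments `∫ ρ(g)_{ai} conj ρ(g)_{bk} dg = δ_{ab} δ_{ik}/N`
(`HasSchurMoments`; `SU(N)`, `U(N)`; the Haar bookkeeping is `GaugeGroupSchurAverages.lean`):
★★ `integral_line_pair` — the gauge average of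
`ρ(hol_p)_{ab} conj ρ(hol_q)_{ab}` is `N⁻² tr ρ(hol_x(p · q̄))`, a Wilson LOOP; ★★ `gaugeAvgL_lineComb_sq`
— `A(|f|²) = N⁻² Σ_{jk} Re(c_j c̄_k W_{jk})`, `W_{jk} = tr ρ(hol_x(p_j · p̄_k))`; ★★★
`loopGram_posSemidef` (`_suN`, `_uN`, `_wilson_suN`) — every linear `ψ` with (P_G) makes the
Hermitian matrix `(ψ^ℂ W(p_k · p̄_j))_{jk}`, `ψ^ℂ W = ψ(Re W) + i ψ(Im W)`, POSITIVE SEMI-DEFINITE: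
the loop-positivity matrices of Anderson–Kruczenski (2017) §3 / Kazakov–Zheng are the constraints
(P_G) on single-entry open strings. NOT here: closed strings at a point (`x = y`, fourth moments —
but `loopGram_append_step` moves the endpoint off `x` without changing the loops); multi-entry /
multi-line strings; Weingarten calculus beyond second moments.

References: P. Anderson, M. Kruczenski, Nucl. Phys. B 921 (2017) §3; V. Kazakov, Z. Zheng,
arXiv:2203.11360 §3, arXiv:2404.16925 §3.1; M. Creutz, *Quarks, gluons and lattices* (1983)
(8.19)–(8.20). Folklore.
-/

noncomputable section

open MeasureTheory
open scoped ComplexConjugate Matrix ComplexOrder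
open Literature.MathematicalPhysics.QuantumFieldTheory (haarProbability Site Edge GaugeConfig
  gaugeTransform IsGaugeInvariant LatticeRep)

namespace Summit.QuantumFields.GaugeBoot

variable {G : Type*} [Group G] [TopologicalSpace G] [IsTopologicalGroup G] [CompactSpace G]
  [MeasurableSpace G] [BorelSpace G] [SecondCountableTopology G] (r : LatticeRep G)

/-! ## The gauge average of a pair of line entries is a Wilson loop -/

section Lines

variable {d L : ℕ} [NeZero L] {r}

/-- ★★ **The gauge average of a product of two Wilson-line entries is `N⁻²` times the Wilson loop
closing the two lines**: for words `p`, `q` from `x` to `y ≠ x`,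
`∫ ρ(hol_x p (U^γ))_{ab} conj ρ(hol_x q (U^γ))_{ab} dγ = N⁻² tr ρ(hol_x(p · q̄) U)`. -/
theorem integral_line_pair (hr : HasSchurMoments r) {x y : Site d L} (hxy : x ≠ y) {p q : Word d}
    (hp : Word.endpoint x p = y) (hq : Word.endpoint x q = y) (a b : Fin r.N) (U : GaugeConfig d L G) :
    ∫ γ, r.ρ (wordHolonomy (gaugeTransform γ U) x p) a b *
        conj (r.ρ (wordHolonomy (gaugeTransform γ U) x q) a b) ∂haarProbability (Site d L → G) =
      ((r.N : ℂ))⁻¹ ^ 2 * (r.ρ (wordHolonomy U x (p ++ q.reverse))).trace := by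
  simp_rw [rho_wordHolonomy_gaugeTransform]
  rw [hp, hq]
  set H := r.ρ (wordHolonomy U x p)
  set H' := r.ρ (wordHolonomy U x q)
  have hcont : Continuous (Function.uncurry fun g h : G =>
      (r.ρ g * H * r.ρ h⁻¹) a b * conj ((r.ρ g * H' * r.ρ h⁻¹) a b)) := by
    have hg : Continuous fun z : G × G => r.ρ z.1 := r.continuous.comp continuous_fst
    have hh : Continuous fun z : G × G => r.ρ z.2⁻¹ := r.continuous.comp continuous_snd.inv
    exact (((hg.mul continuous_const).mul hh).matrix_elem a b).mul
      (Complex.continuous_conj.comp (((hg.mul continuous_const).mul hh).matrix_elem a b))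
  rw [integral_gaugeGroup_pair hxy _ hcont, integral_integral_line_pair hr H H' a b,
    rho_wordHolonomy_append_reverse r U x (hp.trans hq.symm)]

variable {σ : Type*} [Fintype σ]

/-- ★★ **The gauge average of an open-string square is a Gram sum of Wilson loops** (complex form):
for `f = Σ_j c_j ρ(hol_x(p_j))_{ab}` with all `p_j` from `x` to `y ≠ x`,
`A((Re f)² + (Im f)²)(U) = N⁻² Σ_{jk} c_j c̄_k tr ρ(hol_x(p_j · p̄_k) U)`. -/
theorem gaugeAvgL_lineComb_sq_apply (hr : HasSchurMoments r) {x y : Site d L} (hxy : x ≠ y)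
    (p : σ → Word d) (hp : ∀ j, Word.endpoint x (p j) = y) (c : σ → ℂ) (a b : Fin r.N)
    (U : GaugeConfig d L G) :
    ((gaugeAvgL d L G (lineCombRe r x p c a b * lineCombRe r x p c a b +
        lineCombIm r x p c a b * lineCombIm r x p c a b) U : ℝ) : ℂ) =
      ((r.N : ℂ))⁻¹ ^ 2 * ∑ j, ∑ k, c j * conj (c k) *
        (r.ρ (wordHolonomy U x (p j ++ (p k).reverse))).trace := by
  rw [gaugeAvgL_apply, ← integral_complex_ofReal]
  simp_rw [lineComb_normSq_apply]
  have hexp : ∀ γ : Site d L → G,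
      (∑ j, c j * r.ρ (wordHolonomy (gaugeTransform γ U) x (p j)) a b) *
        conj (∑ j, c j * r.ρ (wordHolonomy (gaugeTransform γ U) x (p j)) a b) =
      ∑ j, ∑ k, c j * conj (c k) * (r.ρ (wordHolonomy (gaugeTransform γ U) x (p j)) a b *
        conj (r.ρ (wordHolonomy (gaugeTransform γ U) x (p k)) a b)) := fun γ => by
    rw [map_sum, Finset.sum_mul_sum]
    refine Finset.sum_congr rfl fun j _ => Finset.sum_congr rfl fun k _ => ?_
    rw [map_mul]
    ring
  simp_rw [hexp]
  have hI : ∀ j k, Integrable (fun γ : Site d L → G => c j * conj (c k) *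
      (r.ρ (wordHolonomy (gaugeTransform γ U) x (p j)) a b *
        conj (r.ρ (wordHolonomy (gaugeTransform γ U) x (p k)) a b))) (haarProbability (Site d L → G)) :=
    fun j k => by
    refine Continuous.integrable_of_hasCompactSupport ?_ (HasCompactSupport.of_compactSpace _)
    have hγ : Continuous fun γ : Site d L → G => gaugeTransform γ U :=
      gaugeTransform_action.2.comp (continuous_id.prodMk continuous_const)
    exact continuous_const.mul ((((continuous_rho_wordHolonomy r x (p j)).comp hγ).matrix_elem a b).mul
      (Complex.continuous_conj.comp (((continuous_rho_wordHolonomy r x (p k)).comp hγ).matrix_elem a b)))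
  rw [integral_finsetSum _ fun j _ => integrable_finsetSum _ fun k _ => hI j k, Finset.mul_sum]
  refine Finset.sum_congr rfl fun j _ => ?_
  rw [integral_finsetSum _ fun k _ => hI j k, Finset.mul_sum]
  refine Finset.sum_congr rfl fun k _ => ?_
  rw [integral_const_mul, integral_line_pair hr hxy (hp j) (hp k) a b U]
  ring

/-- ★★ **The same as an identity of observables**: `A((Re f)² + (Im f)²) =
N⁻² Σ_{jk} (Re(c_j c̄_k) · Re W_{jk} - Im(c_j c̄_k) · Im W_{jk})`, `W_{jk} = tr ρ(hol_x(p_j · p̄_k))`. -/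
theorem gaugeAvgL_lineComb_sq (hr : HasSchurMoments r) {x y : Site d L} (hxy : x ≠ y)
    (p : σ → Word d) (hp : ∀ j, Word.endpoint x (p j) = y) (c : σ → ℂ) (a b : Fin r.N) :
    gaugeAvgL d L G (lineCombRe r x p c a b * lineCombRe r x p c a b +
        lineCombIm r x p c a b * lineCombIm r x p c a b) =
      ∑ j, ∑ k, ((((r.N : ℝ))⁻¹ ^ 2 * (c j * conj (c k)).re) • loopRe r x (p j ++ (p k).reverse) -
        (((r.N : ℝ))⁻¹ ^ 2 * (c j * conj (c k)).im) • loopIm r x (p j ++ (p k).reverse)) := by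
  ext U
  have h := congrArg Complex.re (gaugeAvgL_lineComb_sq_apply hr hxy p hp c a b U)
  rw [Complex.ofReal_re] at h
  rw [h]
  simp only [ContinuousMap.coe_sum, ContinuousMap.coe_sub, ContinuousMap.coe_smul, Finset.sum_apply,
    Pi.sub_apply, Pi.smul_apply, loopRe_apply, loopIm_apply, smul_eq_mul, Complex.re_sum,
    Complex.mul_re, Complex.mul_im, Finset.mul_sum]
  refine Finset.sum_congr rfl fun j _ => Finset.sum_congr rfl fun k _ => ?_
  have e1 : (((r.N : ℂ))⁻¹ ^ 2).re = ((r.N : ℝ))⁻¹ ^ 2 := by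
    rw [← Complex.ofReal_natCast, ← Complex.ofReal_inv, ← Complex.ofReal_pow, Complex.ofReal_re]
  have e2 : (((r.N : ℂ))⁻¹ ^ 2).im = 0 := by
    rw [← Complex.ofReal_natCast, ← Complex.ofReal_inv, ← Complex.ofReal_pow, Complex.ofReal_im]
  rw [e1, e2]
  ring

end Lines

/-! ## Loop positivity -/

section Gram

variable {d L : ℕ} [NeZero L] {σ : Type*} [Fintype σ]

/-- **The loop Gram matrix** of a linear functional `ψ` on a finite family of words `p_j` from a
common base point `x`: `(ψ (Re W) + i ψ (Im W))` at `W = tr ρ(hol_x(p_k · p̄_j))`. For `ψ` an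
expectation this is the matrix `⟨tr ρ(hol(p_k p_j⁻¹))⟩_{jk}` of Anderson–Kruczenski / Kazakov–Zheng.
[folklore] -/
def loopGram (ψ : C(GaugeConfig d L G, ℝ) →ₗ[ℝ] ℝ) (x : Site d L) (p : σ → Word d) : Matrix σ σ ℂ :=
  Matrix.of fun j k => ((ψ (loopRe r x (p k ++ (p j).reverse)) : ℝ) : ℂ) +
    ((ψ (loopIm r x (p k ++ (p j).reverse)) : ℝ) : ℂ) * Complex.I

variable {r}

omit [CompactSpace G] [MeasurableSpace G] [BorelSpace G] [SecondCountableTopology G] [NeZero L]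
  [Fintype σ] in
/-- The loop Gram matrix is Hermitian (words with a common endpoint). -/
theorem loopGram_isHermitian (ψ : C(GaugeConfig d L G, ℝ) →ₗ[ℝ] ℝ) {x y : Site d L}
    (p : σ → Word d) (hp : ∀ j, Word.endpoint x (p j) = y) : (loopGram r ψ x p).IsHermitian := by
  ext j k
  simp only [loopGram, Matrix.conjTranspose_apply, Matrix.of_apply, star_add, star_mul,
    Complex.star_def, Complex.conj_ofReal, Complex.conj_I]
  rw [loopRe_swap r x ((hp k).trans (hp j).symm), loopIm_swap r x ((hp k).trans (hp j).symm),
    map_neg, Complex.ofReal_neg]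
  ring

omit [CompactSpace G] [MeasurableSpace G] [BorelSpace G] [SecondCountableTopology G] [NeZero L] in
/-- The quadratic form of the loop Gram matrix. -/
theorem star_dotProduct_loopGram_mulVec (ψ : C(GaugeConfig d L G, ℝ) →ₗ[ℝ] ℝ) (x : Site d L)
    (p : σ → Word d) (c : σ → ℂ) :
    star c ⬝ᵥ (loopGram r ψ x p *ᵥ c) =
      ∑ j, ∑ k, c j * conj (c k) * (((ψ (loopRe r x (p j ++ (p k).reverse)) : ℝ) : ℂ) +
        ((ψ (loopIm r x (p j ++ (p k).reverse)) : ℝ) : ℂ) * Complex.I) := by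
  simp only [dotProduct, Matrix.mulVec, loopGram, Matrix.of_apply, Pi.star_apply, Complex.star_def,
    Finset.mul_sum]
  rw [Finset.sum_comm]
  refine Finset.sum_congr rfl fun j _ => Finset.sum_congr rfl fun k _ => ?_
  ring

/-- ★★ **Loop positivity from (P_G)**, real form: if `0 ≤ ψ (A (a a))` for the two real polynomial
observables `a = Re f`, `Im f`, `f = Σ_j c_j ρ(hol_x(p_j))_{ab}` (words from `x` to `y ≠ x`), then
`0 ≤ Re Σ_{jk} c_j c̄_k ψ^ℂ(tr ρ(hol_x(p_j · p̄_k)))`. -/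
theorem re_sum_loopGram_nonneg (hr : HasSchurMoments r) {x y : Site d L} (hxy : x ≠ y)
    (p : σ → Word d) (hp : ∀ j, Word.endpoint x (p j) = y) (c : σ → ℂ) (a b : Fin r.N)
    (ψ : C(GaugeConfig d L G, ℝ) →ₗ[ℝ] ℝ)
    (hR : 0 ≤ ψ (gaugeAvgL d L G (lineCombRe r x p c a b * lineCombRe r x p c a b)))
    (hI : 0 ≤ ψ (gaugeAvgL d L G (lineCombIm r x p c a b * lineCombIm r x p c a b))) :
    0 ≤ (∑ j, ∑ k, c j * conj (c k) * (((ψ (loopRe r x (p j ++ (p k).reverse)) : ℝ) : ℂ) +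
        ((ψ (loopIm r x (p j ++ (p k).reverse)) : ℝ) : ℂ) * Complex.I)).re := by
  have hN : 0 < r.N := by
    rcases Nat.eq_zero_or_pos r.N with h0 | h0
    · exact absurd a.2 (by omega)
    · exact h0
  have hsum : ψ (gaugeAvgL d L G (lineCombRe r x p c a b * lineCombRe r x p c a b +
      lineCombIm r x p c a b * lineCombIm r x p c a b)) =
      ((r.N : ℝ))⁻¹ ^ 2 * (∑ j, ∑ k, c j * conj (c k) *
        (((ψ (loopRe r x (p j ++ (p k).reverse)) : ℝ) : ℂ) +
          ((ψ (loopIm r x (p j ++ (p k).reverse)) : ℝ) : ℂ) * Complex.I)).re := by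
    rw [gaugeAvgL_lineComb_sq hr hxy p hp c a b]
    simp only [map_sum, map_sub, map_smul, smul_eq_mul, Complex.re_sum, Complex.mul_re,
      Complex.add_re, Complex.add_im, Complex.ofReal_re, Complex.ofReal_im, Complex.mul_im,
      Complex.I_re, Complex.I_im, Finset.mul_sum]
    refine Finset.sum_congr rfl fun j _ => Finset.sum_congr rfl fun k _ => ?_
    ring
  have hpos : 0 ≤ ψ (gaugeAvgL d L G (lineCombRe r x p c a b * lineCombRe r x p c a b +
      lineCombIm r x p c a b * lineCombIm r x p c a b)) := by
    rw [map_add, map_add]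
    exact add_nonneg hR hI
  rw [hsum] at hpos
  have hc : 0 < ((r.N : ℝ))⁻¹ ^ 2 := by positivity
  exact (mul_nonneg_iff_of_pos_left hc).1 hpos

/-- ★★★ **Loop positivity.** For a unitary lattice representation with Schur second moments, a base
site `x`, finitely many words `p_j` from `x` to a common endpoint `y ≠ x`, and ANY linear `ψ`
which is non-negative on the gauge averages of squares of polynomial observables — hypothesis (P_G)
of the bootstrap on gauge-invariant data — the loop Gram matrix `(ψ^ℂ tr ρ(hol_x(p_k · p̄_j)))_{jk}`
is positive semi-definite. [folklore] -/
theorem loopGram_posSemidef (hr : HasSchurMoments r) {x y : Site d L} (hxy : x ≠ y)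
    (p : σ → Word d) (hp : ∀ j, Word.endpoint x (p j) = y) (ψ : C(GaugeConfig d L G, ℝ) →ₗ[ℝ] ℝ)
    (hpos : ∀ a ∈ polyAlgebra (ι := Edge d L) r, 0 ≤ ψ (gaugeAvgL d L G (a * a))) :
    (loopGram r ψ x p).PosSemidef := by
  have hH : (loopGram r ψ x p).IsHermitian := loopGram_isHermitian ψ p hp
  refine Matrix.PosSemidef.of_dotProduct_mulVec_nonneg hH fun c => ?_
  -- Hermitian quadratic forms are real
  have him : (star c ⬝ᵥ (loopGram r ψ x p *ᵥ c)).im = 0 := by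
    have h : star (star c ⬝ᵥ (loopGram r ψ x p *ᵥ c)) = star c ⬝ᵥ (loopGram r ψ x p *ᵥ c) := by
      calc star (star c ⬝ᵥ (loopGram r ψ x p *ᵥ c))
          = star (loopGram r ψ x p *ᵥ c) ⬝ᵥ c := by rw [Matrix.star_dotProduct, star_star]
        _ = (star c ᵥ* (loopGram r ψ x p)ᴴ) ⬝ᵥ c := by rw [Matrix.star_mulVec]
        _ = star c ⬝ᵥ ((loopGram r ψ x p)ᴴ *ᵥ c) := (Matrix.dotProduct_mulVec _ _ _).symm
        _ = star c ⬝ᵥ (loopGram r ψ x p *ᵥ c) := by rw [hH.eq]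
    rw [Complex.star_def] at h
    exact Complex.conj_eq_iff_im.mp h
  rcases isEmpty_or_nonempty (Fin r.N) with hN | ⟨⟨a⟩⟩
  · -- `N = 0`: every loop observable vanishes, so does the Gram matrix
    have h0 : ∀ w : Word d, loopRe r x w = (0 : C(GaugeConfig d L G, ℝ)) ∧
        loopIm r x w = (0 : C(GaugeConfig d L G, ℝ)) := fun w => by
      constructor <;> ext U <;> simp [Matrix.trace]
    have hz : loopGram r ψ x p = 0 := by
      ext j k
      simp [loopGram, (h0 _).1, (h0 _).2]
    rw [hz, Matrix.zero_mulVec, dotProduct_zero]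
  · rw [Complex.le_def]
    refine ⟨?_, by simp [him]⟩
    rw [Complex.zero_re, star_dotProduct_loopGram_mulVec]
    exact re_sum_loopGram_nonneg hr hxy p hp c a a ψ (hpos _ (lineCombRe_mem r x p c a a))
      (hpos _ (lineCombIm_mem r x p c a a))

omit [CompactSpace G] [MeasurableSpace G] [BorelSpace G] [SecondCountableTopology G] [NeZero L]
  [Fintype σ] in
/-- **Moving the endpoint**: appending a common step to all words does not change the loop Gram
matrix (the backtrack cancels), so closed words at `x` reduce to open words `x → x ± e_μ`. -/
theorem loopGram_append_step (ψ : C(GaugeConfig d L G, ℝ) →ₗ[ℝ] ℝ) (x : Site d L) (p : σ → Word d)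
    (s : Step d) : loopGram r ψ x (fun j => p j ++ [s]) = loopGram r ψ x p := by
  have hw : ∀ j k : σ, ∀ U : GaugeConfig d L G,
      wordHolonomy U x ((p k ++ [s]) ++ (p j ++ [s]).reverse) = wordHolonomy U x (p k ++ (p j).reverse) := by
    intro j k U
    rw [Word.reverse_append, show Word.reverse [s] = [s.inv] from rfl, List.append_assoc,
      show [s] ++ ([s.inv] ++ (p j).reverse) = [s, s.inv] ++ (p j).reverse from rfl, ← List.append_assoc,
      wordHolonomy_backtrack]
  ext j k
  simp only [loopGram, Matrix.of_apply]
  have hre : loopRe r x ((p k ++ [s]) ++ (p j ++ [s]).reverse) = loopRe r x (p k ++ (p j).reverse) := by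
    ext U; rw [loopRe_apply, loopRe_apply, hw]
  have himm : loopIm r x ((p k ++ [s]) ++ (p j ++ [s]).reverse) = loopIm r x (p k ++ (p j).reverse) := by
    ext U; rw [loopIm_apply, loopIm_apply, hw]
  rw [hre, himm]

omit [CompactSpace G] [MeasurableSpace G] [BorelSpace G] [SecondCountableTopology G] [NeZero L]
  [Fintype σ] in
/-- On a torus of size `L ≥ 2` a forward step leaves the site. -/
theorem Step.apply_fwd_ne_self (hL : 1 < L) (x : Site d L) (μ : Fin d) : (Step.fwd μ).apply x ≠ x := by
  intro h
  have h1 : (Pi.single μ (1 : ZMod L) : Site d L) μ = 0 := by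
    have := congrFun h μ
    simp only [Step.apply_fwd, Site.shift, Pi.add_apply] at this
    simpa using this
  rw [Pi.single_eq_same] at h1
  have h2 : ((1 : ℕ) : ZMod L) = 0 := by exact_mod_cast h1
  rw [ZMod.natCast_eq_zero_iff] at h2
  exact absurd (Nat.le_of_dvd Nat.one_pos h2) (not_le.2 hL)

/-- ★★★ **Loop positivity for CLOSED words at a site** (`L ≥ 2`, `d ≥ 1`): for finitely many closed
words `p_j` at `x` the loop Gram matrix `(ψ^ℂ tr ρ(hol_x(p_k · p̄_j)))_{jk}` is positive
semi-definite — append a common step to move the endpoint off `x` (`loopGram_append_step`). -/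
theorem loopGram_posSemidef_closed (hr : HasSchurMoments r) (hL : 1 < L) (μ : Fin d) {x : Site d L}
    (p : σ → Word d) (hp : ∀ j, Word.endpoint x (p j) = x) (ψ : C(GaugeConfig d L G, ℝ) →ₗ[ℝ] ℝ)
    (hpos : ∀ a ∈ polyAlgebra (ι := Edge d L) r, 0 ≤ ψ (gaugeAvgL d L G (a * a))) :
    (loopGram r ψ x p).PosSemidef := by
  rw [← loopGram_append_step ψ x p (Step.fwd μ)]
  refine loopGram_posSemidef hr (Step.apply_fwd_ne_self hL x μ).symm (fun j => p j ++ [Step.fwd μ])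
    (fun j => ?_) ψ hpos
  rw [Word.endpoint_append, hp j]
  rfl

end Gram

/-! ## `SU(N)` and `U(N)` -/

section Unitary

open Literature.MathematicalPhysics.QuantumLattice
open Literature.MathematicalPhysics.QuantumFieldTheory (wilsonMeasure)

variable {d L : ℕ} [NeZero L] {σ : Type*} [Fintype σ]

/-- ★★★ **`SU(N)` loop positivity**: every linear functional satisfying (P_G) — in particular every
solution of the bootstrap on gauge-invariant data — has positive semi-definite loop Gram matrices
`(ψ^ℂ tr (hol_x(p_k · p̄_j)))_{jk}` for words from `x` to a common `y ≠ x`. [folklore] -/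
theorem loopGram_posSemidef_suN (N : ℕ) {x y : Site d L} (hxy : x ≠ y) (p : σ → Word d)
    (hp : ∀ j, Word.endpoint x (p j) = y)
    (ψ : C(GaugeConfig d L (Matrix.specialUnitaryGroup (Fin N) ℂ), ℝ) →ₗ[ℝ] ℝ)
    (hpos : ∀ a ∈ polyAlgebra (ι := Edge d L) (fundamentalLatticeRep N),
      0 ≤ ψ (gaugeAvgL d L _ (a * a))) :
    (loopGram (fundamentalLatticeRep N) ψ x p).PosSemidef :=
  loopGram_posSemidef (hasSchurMoments_suN N) hxy p hp ψ hpos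

/-- ★★★ **`U(N)` loop positivity.** [folklore] -/
theorem loopGram_posSemidef_uN (N : ℕ) {x y : Site d L} (hxy : x ≠ y) (p : σ → Word d)
    (hp : ∀ j, Word.endpoint x (p j) = y)
    (ψ : C(GaugeConfig d L (Matrix.unitaryGroup (Fin N) ℂ), ℝ) →ₗ[ℝ] ℝ)
    (hpos : ∀ a ∈ polyAlgebra (ι := Edge d L) (unitaryFundamentalLatticeRep N),
      0 ≤ ψ (gaugeAvgL d L _ (a * a))) :
    (loopGram (unitaryFundamentalLatticeRep N) ψ x p).PosSemidef :=
  loopGram_posSemidef (hasSchurMoments_uN N) hxy p hp ψ hpos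

/-- ★★★ **`SU(N)`: loop positivity for closed words at a site** (`L ≥ 2`). [folklore] -/
theorem loopGram_posSemidef_closed_suN (N : ℕ) (hL : 1 < L) (μ : Fin d) {x : Site d L}
    (p : σ → Word d) (hp : ∀ j, Word.endpoint x (p j) = x)
    (ψ : C(GaugeConfig d L (Matrix.specialUnitaryGroup (Fin N) ℂ), ℝ) →ₗ[ℝ] ℝ)
    (hpos : ∀ a ∈ polyAlgebra (ι := Edge d L) (fundamentalLatticeRep N),
      0 ≤ ψ (gaugeAvgL d L _ (a * a))) :
    (loopGram (fundamentalLatticeRep N) ψ x p).PosSemidef :=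
  loopGram_posSemidef_closed (hasSchurMoments_suN N) hL μ p hp ψ hpos

/-- ★★ **The Wilson loop expectations of `SU(N)` lattice gauge theory form positive semi-definite
Gram matrices** `(⟨Re tr hol(p_k p̄_j)⟩ + i⟨Im tr hol(p_k p̄_j)⟩)_{jk}` (torus, any real `β`;
Anderson–Kruczenski's positivity constraints hold for the true expectations). [folklore] -/
theorem loopGram_posSemidef_wilson_suN (N : ℕ) (β : ℝ) {x y : Site d L} (hxy : x ≠ y)
    (p : σ → Word d) (hp : ∀ j, Word.endpoint x (p j) = y)
    (μ : Measure (GaugeConfig d L (Matrix.specialUnitaryGroup (Fin N) ℂ))) [IsProbabilityMeasure μ]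
    (hμ : μ = wilsonMeasure (fundamentalRep (Fin N)) β) :
    (loopGram (fundamentalLatticeRep N) (expectationFunctional μ) x p).PosSemidef :=
  loopGram_posSemidef_suN N hxy p hp _ fun a _ => (gaugeInvariantBootstrap_wilson_suN N β μ hμ).2.1 a

end Unitary

end Summit.QuantumFields.GaugeBoot

end
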